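import Mathlib.Algebra.BigOperators.Ring.Finset
import Mathlib.Algebra.Order.BigOperators.Ring.Finset
import Mathlib.Data.Finset.Powerset
import Mathlib.Data.Real.Basic
import Mathlib.Tactic.Linarith
import Mathlib.Tactic.Ring
import HarnessLib

/-!
# `NoHeavyLowerTail` (stmt-CriticalPhenomena-4575) — the NESTED CERTIFICATE, algebraic core (any number of comonotone stars)

Support file (prover `prim-gen-swap` gen 6; `--supports stmt-CriticalPhenomena-4575`).  No definitions, no named facts, no sorries; Mathlib only.

Step (4) of the level-two observer-set theorem for two-port star sets (seat memo R3-SEATS.md §5/§7, blueprint LEAN-BLUEPRINT-StarSet.md) is the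
pointwise inequality  `E(π) ≥ Σ_i θ_i Π_{i'<i}(1−θ_{i'}) · K_{p_i}(π)`  for `m` comonotone two-port stars (star `i` open with probability `θ_i`,
independently; `σ` = the set of open stars, `w(σ) = Π_{i∈σ} θ_i Π_{i∉σ}(1−θ_i)`).  Once the three combinatorial facts of the matching case are
available pointwise — (i) the ρ-part of `E` is the lightness indicator `g(σ)` of the witness, (ii) the lonely part `ℓ(σ)` vanishes unless exactly
one star is open, (iii) `ℓ({i}) ≤ sp_i(σ)` (if star `i` alone can be lonely then its designated port is light in EVERY pattern) — the inequality is
pure bookkeeping over the product law of `σ`.  This file proves that bookkeeping once and for all: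

* `StarSet.patternWeight_sum` — `Σ_{σ ⊆ univ} w(σ) = 1` (`Finset.prod_add`);
* `StarSet.nestedCoeff_sum` — `Σ_i θ_iΠ_{j<i}(1−θ_j) = 1 − Π_i(1−θ_i)` (`Finset.prod_one_sub_ordered`);
* `StarSet.patternWeight_singleton_le_nestedCoeff` — `w({i}) ≤ θ_iΠ_{j<i}(1−θ_j)`;
* `StarSet.nestedCertificate_core` — **`Σ_i c_i·Σ_σ w(σ)(g(σ) − sp_i(σ)) ≤ Σ_σ w(σ)(g(σ) − ℓ(σ))`** under (i)–(iii), `g ≥ 0`, `ℓ({i}) ≥ 0`, `θ_i ∈ [0,1]`.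
-/

namespace Summit.CriticalPhenomena.PercolationContinuityZ3.Theorems

open Finset
open scoped BigOperators

namespace StarSet

variable {ι : Type*} [Fintype ι] [DecidableEq ι]

/-- The pattern weights `w(σ) = Π_{i∈σ} θ_i · Π_{i∉σ} (1−θ_i)` are nonnegative for `θ ∈ [0,1]^ι`. [folklore] -/
theorem patternWeight_nonneg (θ : ι → ℝ) (hθ0 : ∀ i, 0 ≤ θ i) (hθ1 : ∀ i, θ i ≤ 1) (σ : Finset ι) :
    0 ≤ (∏ i ∈ σ, θ i) * ∏ i ∈ univ \ σ, (1 - θ i) :=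
  mul_nonneg (prod_nonneg fun i _ => hθ0 i) (prod_nonneg fun i _ => sub_nonneg.2 (hθ1 i))

/-- The pattern weights sum to one: `Σ_{σ ⊆ univ} Π_{i∈σ} θ_i Π_{i∉σ}(1−θ_i) = Π_i (θ_i + (1−θ_i)) = 1`. [folklore] -/
theorem patternWeight_sum (θ : ι → ℝ) :
    ∑ σ ∈ (univ : Finset ι).powerset, (∏ i ∈ σ, θ i) * ∏ i ∈ univ \ σ, (1 - θ i) = 1 := by
  rw [← prod_add]
  simp

omit [DecidableEq ι] in
/-- The nested coefficients telescope: `Σ_i θ_i Π_{j<i}(1−θ_j) = 1 − Π_i (1−θ_i)`. [folklore] -/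
theorem nestedCoeff_sum [LinearOrder ι] (θ : ι → ℝ) :
    ∑ i, θ i * ∏ j ∈ univ.filter (· < i), (1 - θ j) = 1 - ∏ i, (1 - θ i) := by
  rw [prod_one_sub_ordered]
  ring

/-- `w({i}) ≤ c_i`: `θ_i Π_{j≠i}(1−θ_j) ≤ θ_i Π_{j<i}(1−θ_j)` for `θ ∈ [0,1]^ι`. [folklore] -/
theorem patternWeight_singleton_le_nestedCoeff [LinearOrder ι] (θ : ι → ℝ) (hθ0 : ∀ i, 0 ≤ θ i) (hθ1 : ∀ i, θ i ≤ 1) (i : ι) :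
    (∏ j ∈ ({i} : Finset ι), θ j) * ∏ j ∈ univ \ {i}, (1 - θ j) ≤ θ i * ∏ j ∈ univ.filter (· < i), (1 - θ j) := by
  rw [prod_singleton]
  refine mul_le_mul_of_nonneg_left ?_ (hθ0 i)
  have hsub : univ.filter (· < i) ⊆ (univ : Finset ι) \ {i} := by
    intro j hj
    rw [mem_filter] at hj
    rw [mem_sdiff, mem_singleton]
    exact ⟨mem_univ j, ne_of_lt hj.2⟩
  rw [← prod_sdiff hsub]
  have h1 : ∏ j ∈ (univ \ {i}) \ univ.filter (· < i), (1 - θ j) ≤ 1 :=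
    prod_le_one (fun j _ => sub_nonneg.2 (hθ1 j)) (fun j _ => sub_le_self 1 (hθ0 j))
  have h2 : 0 ≤ ∏ j ∈ univ.filter (· < i), (1 - θ j) := prod_nonneg fun j _ => sub_nonneg.2 (hθ1 j)
  calc (∏ j ∈ (univ \ {i}) \ univ.filter (· < i), (1 - θ j)) * ∏ j ∈ univ.filter (· < i), (1 - θ j)
      ≤ 1 * ∏ j ∈ univ.filter (· < i), (1 - θ j) := mul_le_mul_of_nonneg_right h1 h2
    _ = ∏ j ∈ univ.filter (· < i), (1 - θ j) := one_mul _

omit [DecidableEq ι] in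
/-- A pattern function vanishing off the singletons sums, against the pattern weights, to its singleton values. [folklore] -/
theorem sum_powerset_eq_sum_singleton (W ℓ : Finset ι → ℝ) (hℓ0 : ∀ σ : Finset ι, (∀ i, σ ≠ {i}) → ℓ σ = 0) :
    ∑ σ ∈ (univ : Finset ι).powerset, W σ * ℓ σ = ∑ i, W {i} * ℓ {i} := by
  have hsub : (univ : Finset ι).powersetCard 1 ⊆ (univ : Finset ι).powerset :=
    fun σ hσ => mem_powerset.2 (mem_powersetCard.1 hσ).1
  rw [← sum_subset hsub]
  · rw [powersetCard_one, sum_map]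
    rfl
  · intro σ _ hσ
    have hne : ∀ i, σ ≠ {i} := by
      intro i h
      apply hσ
      rw [mem_powersetCard]
      exact ⟨subset_univ _, by rw [h, card_singleton]⟩
    rw [hℓ0 σ hne, mul_zero]

/-- **Nested certificate, algebraic core.**  `θ ∈ [0,1]^ι`, pattern weights `w(σ) = Π_{i∈σ}θ_iΠ_{i∉σ}(1−θ_i)`, nested coefficients
`c_i = θ_iΠ_{j<i}(1−θ_j)`; `g ≥ 0` (witness-lightness part), `ℓ` vanishing off singletons with `0 ≤ ℓ({i}) ≤ sp_i(σ)` for all `σ`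
(designated-port lightness).  Then `Σ_i c_i Σ_σ w(σ)(g(σ) − sp_i(σ)) ≤ Σ_σ w(σ)(g(σ) − ℓ(σ))`. [this file] -/
theorem nestedCertificate_core [LinearOrder ι] (θ : ι → ℝ) (hθ0 : ∀ i, 0 ≤ θ i) (hθ1 : ∀ i, θ i ≤ 1)
    (g ℓ : Finset ι → ℝ) (sp : ι → Finset ι → ℝ)
    (hg : ∀ σ, 0 ≤ g σ) (hℓ0 : ∀ σ : Finset ι, (∀ i, σ ≠ {i}) → ℓ σ = 0)
    (hℓnn : ∀ i, 0 ≤ ℓ {i}) (hℓsp : ∀ i σ, ℓ {i} ≤ sp i σ) :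
    ∑ i, (θ i * ∏ j ∈ univ.filter (· < i), (1 - θ j)) *
        ∑ σ ∈ (univ : Finset ι).powerset, ((∏ k ∈ σ, θ k) * ∏ k ∈ univ \ σ, (1 - θ k)) * (g σ - sp i σ) ≤
      ∑ σ ∈ (univ : Finset ι).powerset, ((∏ k ∈ σ, θ k) * ∏ k ∈ univ \ σ, (1 - θ k)) * (g σ - ℓ σ) := by
  set W : Finset ι → ℝ := fun σ => (∏ k ∈ σ, θ k) * ∏ k ∈ univ \ σ, (1 - θ k) with hW
  set c : ι → ℝ := fun i => θ i * ∏ j ∈ univ.filter (· < i), (1 - θ j) with hc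
  have hWnn : ∀ σ, 0 ≤ W σ := fun σ => patternWeight_nonneg θ hθ0 hθ1 σ
  have hWsum : ∑ σ ∈ (univ : Finset ι).powerset, W σ = 1 := patternWeight_sum θ
  have hcsum : ∑ i, c i = 1 - ∏ i, (1 - θ i) := nestedCoeff_sum θ
  have hcnn : ∀ i, 0 ≤ c i := fun i => mul_nonneg (hθ0 i) (prod_nonneg fun j _ => sub_nonneg.2 (hθ1 j))
  have hcW : ∀ i, W {i} ≤ c i := fun i => patternWeight_singleton_le_nestedCoeff θ hθ0 hθ1 i
  have hPnn : 0 ≤ ∏ i, (1 - θ i) := prod_nonneg fun i _ => sub_nonneg.2 (hθ1 i)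
  -- abbreviations for the aggregated quantities
  set G : ℝ := ∑ σ ∈ (univ : Finset ι).powerset, W σ * g σ with hG
  have hGnn : 0 ≤ G := sum_nonneg fun σ _ => mul_nonneg (hWnn σ) (hg σ)
  -- the lonely part collapses to the singletons
  have hL : ∑ σ ∈ (univ : Finset ι).powerset, W σ * ℓ σ = ∑ i, W {i} * ℓ {i} :=
    sum_powerset_eq_sum_singleton W ℓ hℓ0
  -- the designated-port part of star `i` is at least `ℓ({i})`
  have hSp : ∀ i, ℓ {i} ≤ ∑ σ ∈ (univ : Finset ι).powerset, W σ * sp i σ := by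
    intro i
    calc ℓ {i} = ∑ σ ∈ (univ : Finset ι).powerset, W σ * ℓ {i} := by rw [← sum_mul, hWsum, one_mul]
      _ ≤ ∑ σ ∈ (univ : Finset ι).powerset, W σ * sp i σ :=
          sum_le_sum fun σ _ => mul_le_mul_of_nonneg_left (hℓsp i σ) (hWnn σ)
  -- rewrite both sides
  have hR : ∑ σ ∈ (univ : Finset ι).powerset, W σ * (g σ - ℓ σ) = G - ∑ i, W {i} * ℓ {i} := by
    rw [← hL, hG, ← sum_sub_distrib]
    refine sum_congr rfl fun σ _ => ?_
    ring
  have hLft : ∀ i, c i * ∑ σ ∈ (univ : Finset ι).powerset, W σ * (g σ - sp i σ) ≤ c i * (G - ℓ {i}) := by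
    intro i
    refine mul_le_mul_of_nonneg_left ?_ (hcnn i)
    have : ∑ σ ∈ (univ : Finset ι).powerset, W σ * (g σ - sp i σ) =
        G - ∑ σ ∈ (univ : Finset ι).powerset, W σ * sp i σ := by
      rw [hG, ← sum_sub_distrib]
      refine sum_congr rfl fun σ _ => ?_
      ring
    rw [this]
    linarith [hSp i]
  calc ∑ i, c i * ∑ σ ∈ (univ : Finset ι).powerset, W σ * (g σ - sp i σ)
      ≤ ∑ i, c i * (G - ℓ {i}) := sum_le_sum fun i _ => hLft i
    _ = (∑ i, c i) * G - ∑ i, c i * ℓ {i} := by rw [sum_mul, ← sum_sub_distrib]; refine sum_congr rfl fun i _ => ?_; ring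
    _ ≤ G - ∑ i, W {i} * ℓ {i} := by
        rw [hcsum]
        have h1 : ∑ i, W {i} * ℓ {i} ≤ ∑ i, c i * ℓ {i} :=
          sum_le_sum fun i _ => mul_le_mul_of_nonneg_right (hcW i) (hℓnn i)
        nlinarith [h1, hGnn, hPnn, mul_nonneg hPnn hGnn]
    _ = ∑ σ ∈ (univ : Finset ι).powerset, W σ * (g σ - ℓ σ) := hR.symm

end StarSet

end Summit.CriticalPhenomena.PercolationContinuityZ3.Theorems
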